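import Mathlib
import Summits.Ventures.PercRepro2.Defs
import Summits.Ventures.PercRepro2.Graph
import Summits.Ventures.PercRepro2.OneColourSwitch
import Summits.Ventures.PercRepro2.RegionHubSign
import Summits.Ventures.PercRepro2.SideSwitch
import Summits.Ventures.PercRepro2.SideSwitchM9
import Summits.Ventures.PercRepro2.SideSwitchClosed
import Summits.Ventures.PercRepro2.SideSwitchComps
import Summits.Ventures.PercRepro2.SideSwitchFibre
import Summits.Ventures.PercRepro2.TermSwitchDefs
import Summits.Ventures.PercRepro2.TermSwitchFibre
import Summits.Ventures.PercRepro2.TermSwitchCompsFibre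
import Summits.Ventures.PercRepro2.TermSwitchMono
import Summits.Ventures.PercRepro2.TermSwitchM9
import Summits.Ventures.PercRepro2.TermSwitchReach
import Summits.Ventures.PercRepro2.TermSwitchRestrict
import Summits.Ventures.PercRepro2.M9NoPocketDefs
import Summits.Ventures.PercRepro2.M9GeneralDSplit
import Summits.Ventures.PercRepro2.M9ReachedSum
import Summits.Ventures.PercRepro2.M9FourParts
import Summits.Ventures.PercRepro2.M9CornerHarris
import Summits.Ventures.PercRepro2.M9OneSidedFibre
import Summits.Ventures.PercRepro2.M9OneSidedFibreM
import Summits.Ventures.PercRepro2.M9OneSidedCorner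
import Summits.Ventures.PercRepro2.M9OneSidedTFree
import Summits.Ventures.PercRepro2.M9OneSidedTEdge
import Summits.Ventures.PercRepro2.M9OneSidedTEdgeM
import Summits.Ventures.PercRepro2.M9OneSidedTCorner
import Summits.Ventures.PercRepro2.M9OneSidedTCornerUp

/-!
# THEOREM ⟦Lz⟧ with a `T`-edge: the clean one-sided reached part is non-positive whenever there
is no `r–s` and no `d–s` edge (blind cell PercRepro2, p3 g30, 2026-08-28;
`proofs/P3-HDR.md` §12)

The assembly of `M9OneSidedTFree` with the `T`-edge case analysis of `M9OneSidedTCorner` /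
`M9OneSidedTCornerUp`: per representative the one-sided points are nothing (`cK ∧ cM`), the
down-corner (`cK ∧ ¬cM`), the up-corner (`¬cK ∧ cM`) or the corner pair (neither), and each has
a non-positive paired sum.  Hence **`cleanReachedSum ≤ 0`** (`cleanReachedSum_nonpos_of_tedge`)
and, with `M9FourParts`, **the single-`d` statement follows from `EX + HD ≤ 0` alone** for every
`d` not adjacent to `s` (`dSignSum_nonpos_of_exhd_tedge`) — by the symmetry `r ↔ s` of the
statement, for every `d` adjacent to at most one of `r, s`.  Own work; std axioms.
-/

namespace Summit.Ventures.PercRepro2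

namespace TermSwitch

open Finset Classical RegionHub OneColourSwitch SideSwitch

variable {V : Type*} {E : Type*}

section TEdgeLz

variable [Fintype V] [DecidableEq V] [Fintype E] [DecidableEq E] {ends : E → Sym2 V}
  {p q r s d : V}

omit [Fintype V] [Fintype E] [DecidableEq E] in
/-- The down-corner as a filter of the powerset. -/
lemma filter_inter_empty_eq {A J : Finset (Finset V)} :
    A.powerset.filter (fun T => J ∩ T = ∅) = (A \ J).powerset := by
  ext T
  simp only [Finset.mem_filter, Finset.mem_powerset]
  constructor
  · rintro ⟨hTA, h⟩ B hB
    refine Finset.mem_sdiff.2 ⟨hTA hB, fun hBJ => ?_⟩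
    have : B ∈ J ∩ T := Finset.mem_inter.2 ⟨hBJ, hB⟩
    rw [h] at this; exact Finset.notMem_empty B this
  · intro hT
    refine ⟨fun B hB => (Finset.mem_sdiff.1 (hT hB)).1, ?_⟩
    ext B
    simp only [Finset.mem_inter, Finset.notMem_empty, iff_false, not_and]
    intro hBJ hBT
    exact (Finset.mem_sdiff.1 (hT hBT)).2 hBJ

omit [Fintype V] [Fintype E] [DecidableEq E] in
/-- A sum over the up-corner is a sum over the free parts. -/
lemma sum_filter_subset_eq {A J : Finset (Finset V)} (hJ : J ⊆ A) (h : Finset (Finset V) → ℤ) :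
    ∑ T ∈ A.powerset.filter (fun T => J ⊆ T), h T = ∑ T' ∈ (A \ J).powerset, h (T' ∪ J) := by
  have himg : A.powerset.filter (fun T => J ⊆ T) = ((A \ J).powerset).image (fun T' => T' ∪ J) := by
    ext T
    simp only [Finset.mem_filter, Finset.mem_powerset, Finset.mem_image]
    constructor
    · rintro ⟨hTA, hJT⟩
      refine ⟨T \ J, fun B hB => ?_, ?_⟩
      · obtain ⟨hBT, hBJ⟩ := Finset.mem_sdiff.1 hB
        exact Finset.mem_sdiff.2 ⟨hTA hBT, hBJ⟩
      · ext B
        simp only [Finset.mem_union, Finset.mem_sdiff]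
        constructor
        · rintro (⟨h1, _⟩ | h1)
          · exact h1
          · exact hJT h1
        · intro hBT
          by_cases hBJ : B ∈ J
          · exact Or.inr hBJ
          · exact Or.inl ⟨hBT, hBJ⟩
    · rintro ⟨T', hT', rfl⟩
      refine ⟨?_, Finset.subset_union_right⟩
      intro B hB
      rcases Finset.mem_union.1 hB with hB | hB
      · exact (Finset.mem_sdiff.1 (hT' hB)).1
      · exact hJ hB
  have hinj : Set.InjOn (fun T' : Finset (Finset V) => T' ∪ J) ↑((A \ J).powerset) := by
    intro T hT T' hT' heq
    have hT1 := Finset.mem_powerset.1 (Finset.mem_coe.1 hT)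
    have hT2 := Finset.mem_powerset.1 (Finset.mem_coe.1 hT')
    ext B
    constructor
    · intro hB
      have hBJ : B ∉ J := (Finset.mem_sdiff.1 (hT1 hB)).2
      have : B ∈ T' ∪ J := by
        have h : B ∈ T ∪ J := Finset.mem_union_left _ hB
        simpa [heq] using h
      rcases Finset.mem_union.1 this with h | h
      · exact h
      · exact absurd h hBJ
    · intro hB
      have hBJ : B ∉ J := (Finset.mem_sdiff.1 (hT2 hB)).2
      have : B ∈ T ∪ J := by
        have h : B ∈ T' ∪ J := Finset.mem_union_left _ hB
        simpa [heq] using h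
      rcases Finset.mem_union.1 this with h | h
      · exact h
      · exact absurd h hBJ
  rw [himg, Finset.sum_image hinj]

/-- **The one-sided paired fibre sum of a representative is non-positive** (with a `T`-edge
`d–r` allowed). -/
theorem oneSided_fibre_sum_nonpos_T (hT : TEdge ends r s d) {ρ : Config E}
    (hρ : ρ ∈ RepH ends p q ({r, s, d} : Set V)) :
    (∑ T ∈ (compsH ends ({r, s, d} : Set V) ρ).powerset,
      (if NoPocket.OneSided ends r s d (assignC ends T ρ) then
        (sigma ends (assignC ends T ρ) p q +
          sigma ends (assignC ends T (flipOH ends ({r, s, d} : Set V) ρ)) p q) *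
          sigma ends (assignC ends T ρ) r s else 0)) ≤ 0 := by
  have hρM : ∀ x ∈ MH ends ({r, s, d} : Set V) ρ, x ∈ ({r, s, d} : Set V) := (mem_RepH.1 hρ).2
  have hr : r ∈ ({r, s, d} : Set V) := r_mem_triple r s d
  have hJA : joinSetT ends r s d ρ ⊆ compsH ends ({r, s, d} : Set V) ρ := Finset.filter_subset _ _
  -- the summand as a function
  set f : Finset (Finset V) → ℤ := fun T =>
    (sigma ends (assignC ends T ρ) p q +
      sigma ends (assignC ends T (flipOH ends ({r, s, d} : Set V) ρ)) p q) *
      sigma ends (assignC ends T ρ) r s with hf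
  have hiff : ∀ T ∈ (compsH ends ({r, s, d} : Set V) ρ).powerset,
      (NoPocket.OneSided ends r s d (assignC ends T ρ) ↔
        (cK ends r s d ρ ∧ ¬ cM ends r s d ρ ∧ joinSetT ends r s d ρ ∩ T = ∅) ∨
        (¬ cK ends r s d ρ ∧ cM ends r s d ρ ∧ joinSetT ends r s d ρ ⊆ T) ∨
        (¬ cK ends r s d ρ ∧ ¬ cM ends r s d ρ ∧ (joinSetT ends r s d ρ).Nonempty ∧
          (joinSetT ends r s d ρ ∩ T = ∅ ∨ joinSetT ends r s d ρ ⊆ T))) :=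
    fun T hT' => oneSided_assignC_iff_T hT hρM (Finset.mem_powerset.1 hT')
  rw [← Finset.sum_filter]
  by_cases hcK : cK ends r s d ρ <;> by_cases hcM : cM ends r s d ρ
  · -- doubly reached through the `T`-edges: no one-sided point
    refine le_of_eq (Finset.sum_eq_zero fun T hT' => ?_)
    exfalso
    obtain ⟨hTA, hone⟩ := Finset.mem_filter.1 hT'
    rcases (hiff T hTA).1 hone with ⟨_, h, _⟩ | ⟨h, _, _⟩ | ⟨h, _, _, _⟩
    · exact h hcM
    · exact h hcK
    · exact h hcK
  · -- the down-corner
    have hset : (compsH ends ({r, s, d} : Set V) ρ).powerset.filter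
        (fun T => NoPocket.OneSided ends r s d (assignC ends T ρ)) =
        (compsH ends ({r, s, d} : Set V) ρ \ joinSetT ends r s d ρ).powerset := by
      rw [← filter_inter_empty_eq]
      refine Finset.filter_congr fun T hT' => ?_
      rw [hiff T hT']
      constructor
      · rintro (⟨_, _, h⟩ | ⟨h, _, _⟩ | ⟨h, _, _, _⟩)
        · exact h
        · exact absurd hcK h
        · exact absurd hcK h
      · intro h
        exact Or.inl ⟨hcK, hcM, h⟩
    rw [hset]
    exact down_corner_sum_nonpos hT hρ hcM
  · -- the up-corner
    have hset : (compsH ends ({r, s, d} : Set V) ρ).powerset.filter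
        (fun T => NoPocket.OneSided ends r s d (assignC ends T ρ)) =
        (compsH ends ({r, s, d} : Set V) ρ).powerset.filter (fun T => joinSetT ends r s d ρ ⊆ T) := by
      refine Finset.filter_congr fun T hT' => ?_
      rw [hiff T hT']
      constructor
      · rintro (⟨h, _, _⟩ | ⟨_, _, h⟩ | ⟨_, h, _, _⟩)
        · exact absurd h hcK
        · exact h
        · exact absurd hcM h
      · intro h
        exact Or.inr (Or.inl ⟨hcK, hcM, h⟩)
    rw [hset, sum_filter_subset_eq hJA]
    exact up_corner_sum_nonpos hT hρ hcK
  · -- the corner pair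
    by_cases hJ : (joinSetT ends r s d ρ).Nonempty
    · have hset : (compsH ends ({r, s, d} : Set V) ρ).powerset.filter
          (fun T => NoPocket.OneSided ends r s d (assignC ends T ρ)) =
          corners (compsH ends ({r, s, d} : Set V) ρ) (joinSetT ends r s d ρ) := by
        unfold corners
        refine Finset.filter_congr fun T hT' => ?_
        rw [hiff T hT']
        constructor
        · rintro (⟨h, _, _⟩ | ⟨_, h, _⟩ | ⟨_, _, _, h⟩)
          · exact absurd h hcK
          · exact absurd h hcM
          · exact h
        · intro h
          exact Or.inr (Or.inr ⟨hcK, hcM, hJ, h⟩)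
      rw [hset]
      exact corner_fibre_sum_nonpos hρ hr s hJA hJ
    · refine le_of_eq (Finset.sum_eq_zero fun T hT' => ?_)
      exfalso
      obtain ⟨hTA, hone⟩ := Finset.mem_filter.1 hT'
      rcases (hiff T hTA).1 hone with ⟨h, _, _⟩ | ⟨_, h, _⟩ | ⟨_, _, h, _⟩
      · exact hcK h
      · exact hcM h
      · exact hJ h

/-- **THEOREM ⟦Lz⟧ with a `T`-edge**: the clean one-sided reached part of the single-`d` sum is
non-positive whenever there is no `r–s` edge and no `d–s` edge (`d` may be adjacent to `r`). -/
theorem cleanReachedSum_nonpos_of_tedge (hT : TEdge ends r s d) :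
    NoPocket.cleanReachedSum ends p q r s d ≤ 0 := by
  rw [cleanReachedSum_eq_dzeroSignSumHP]
  have hr : r ∈ ({r, s, d} : Set V) := r_mem_triple r s d
  have hsum : dzeroSignSumHP ends p q r s ({r, s, d} : Set V) (NoPocket.OneSided ends r s d) =
      ∑ ρ ∈ RepH ends p q ({r, s, d} : Set V), ∑ T ∈ (compsH ends ({r, s, d} : Set V) ρ).powerset,
        (if NoPocket.OneSided ends r s d (assignC ends T ρ) then sigma ends (assignC ends T ρ) p q *
          sigma ends (assignC ends T ρ) r s else 0) := by
    have h1 : dzeroSignSumHP ends p q r s ({r, s, d} : Set V) (NoPocket.OneSided ends r s d) =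
        ∑ ω ∈ DZeroSetH ends p q ({r, s, d} : Set V),
          if NoPocket.OneSided ends r s d ω then sigma ends ω p q * sigma ends ω r s else 0 := by
      have hset : DZeroSetH ends p q ({r, s, d} : Set V) =
          univ.filter (fun ω => sepH ends p q ({r, s, d} : Set V) ω ∧
            DZeroH ends ({r, s, d} : Set V) ω) := by
        ext ω; simp [DZeroSetH, SepSetH]
      rw [hset, Finset.sum_filter, dzeroSignSumHP]
      refine Finset.sum_congr rfl (fun ω _ => ?_)
      by_cases h1 : sepH ends p q ({r, s, d} : Set V) ω ∧ DZeroH ends ({r, s, d} : Set V) ω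
      · by_cases h2 : NoPocket.OneSided ends r s d ω
        · rw [if_pos ⟨h1.1, h1.2, h2⟩, if_pos h1, if_pos h2]
        · rw [if_neg (fun h => h2 h.2.2), if_pos h1, if_neg h2]
      · rw [if_neg (fun h => h1 ⟨h.1, h.2.1⟩), if_neg h1]
    rw [h1, sum_dzeroH_eq_sum_repH_comps (fun ω => if NoPocket.OneSided ends r s d ω then
      sigma ends ω p q * sigma ends ω r s else 0)]
  have hsumO : (∑ ρ ∈ RepH ends p q ({r, s, d} : Set V),
        ∑ T ∈ (compsH ends ({r, s, d} : Set V) ρ).powerset,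
        (if NoPocket.OneSided ends r s d (assignC ends T ρ) then sigma ends (assignC ends T ρ) p q *
          sigma ends (assignC ends T ρ) r s else 0)) =
      ∑ ρ ∈ RepH ends p q ({r, s, d} : Set V),
        ∑ T ∈ (compsH ends ({r, s, d} : Set V) ρ).powerset,
        (if NoPocket.OneSided ends r s d (assignC ends T ρ) then
          sigma ends (assignC ends T (flipOH ends ({r, s, d} : Set V) ρ)) p q *
          sigma ends (assignC ends T ρ) r s else 0) := by
    symm
    refine Finset.sum_nbij' (fun ρ => flipOH ends ({r, s, d} : Set V) ρ)
      (fun ρ => flipOH ends ({r, s, d} : Set V) ρ)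
      (fun ρ hρ => flipOH_mem_RepH hρ) (fun ρ hρ => flipOH_mem_RepH hρ)
      (fun ρ _ => flipOH_flipOH ({r, s, d} : Set V) ρ)
      (fun ρ _ => flipOH_flipOH ({r, s, d} : Set V) ρ) ?_
    intro ρ _
    rw [compsH_flipOH]
    refine Finset.sum_congr rfl (fun T hT' => ?_)
    have hTc : T ⊆ compsH ends ({r, s, d} : Set V) ρ := Finset.mem_powerset.1 hT'
    rw [oneSided_assignC_flipOH_iff hTc, sigma_rs_assignC_flipOH hr s hTc]
  have htwice : 2 * dzeroSignSumHP ends p q r s ({r, s, d} : Set V)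
      (NoPocket.OneSided ends r s d) ≤ 0 := by
    calc 2 * dzeroSignSumHP ends p q r s ({r, s, d} : Set V) (NoPocket.OneSided ends r s d)
        = dzeroSignSumHP ends p q r s ({r, s, d} : Set V) (NoPocket.OneSided ends r s d) +
          dzeroSignSumHP ends p q r s ({r, s, d} : Set V) (NoPocket.OneSided ends r s d) := by ring
      _ = (∑ ρ ∈ RepH ends p q ({r, s, d} : Set V),
            ∑ T ∈ (compsH ends ({r, s, d} : Set V) ρ).powerset,
            (if NoPocket.OneSided ends r s d (assignC ends T ρ) then
              sigma ends (assignC ends T ρ) p q * sigma ends (assignC ends T ρ) r s else 0)) +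
          ∑ ρ ∈ RepH ends p q ({r, s, d} : Set V),
            ∑ T ∈ (compsH ends ({r, s, d} : Set V) ρ).powerset,
            (if NoPocket.OneSided ends r s d (assignC ends T ρ) then
              sigma ends (assignC ends T (flipOH ends ({r, s, d} : Set V) ρ)) p q *
              sigma ends (assignC ends T ρ) r s else 0) := by
          rw [← hsumO, ← hsum]
      _ = ∑ ρ ∈ RepH ends p q ({r, s, d} : Set V),
            ∑ T ∈ (compsH ends ({r, s, d} : Set V) ρ).powerset,
            (if NoPocket.OneSided ends r s d (assignC ends T ρ) then
              (sigma ends (assignC ends T ρ) p q +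
                sigma ends (assignC ends T (flipOH ends ({r, s, d} : Set V) ρ)) p q) *
                sigma ends (assignC ends T ρ) r s else 0) := by
          rw [← Finset.sum_add_distrib]
          refine Finset.sum_congr rfl (fun ρ _ => ?_)
          rw [← Finset.sum_add_distrib]
          refine Finset.sum_congr rfl (fun T _ => ?_)
          by_cases hP' : NoPocket.OneSided ends r s d (assignC ends T ρ)
          · simp only [if_pos hP']
            ring
          · simp only [if_neg hP', add_zero]
      _ ≤ 0 := Finset.sum_nonpos (fun ρ hρ => oneSided_fibre_sum_nonpos_T hT hρ)
  linarith

/-- **The single-`d` statement from `EX + HD ≤ 0` alone, for `d` not adjacent to `s`** (no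
`r–s` edge). -/
theorem dSignSum_nonpos_of_exhd_tedge (hT : TEdge ends r s d)
    (h : NoPocket.exSum ends p q r s d + NoPocket.hdSum ends p q r s d ≤ 0) :
    NoPocket.dSignSum ends p q r s d ≤ 0 :=
  NoPocket.dSignSum_nonpos_of_exhd_lz h (cleanReachedSum_nonpos_of_tedge hT)

end TEdgeLz

end TermSwitch

end Summit.Ventures.PercRepro2
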